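import Literature.Geometry.Riemannian.SphericalZonalSixDuality
import Mathlib.Topology.ContinuousMap.Weierstrass
import HarnessLib

/-!
# Non-negativity of the `S⁶` zonal heat series and monotonicity of the `S⁴` zonal kernel

Last file on the typed zonal heat series of `SphericalCylinderEntropy`.  For every `τ > 0`:

* `zonalSix_nonneg` — **`zonalSix τ s ≥ 0` for `s ∈ [-1, 1]`** (positivity of the heat kernel of
  the round `S⁶`, in the typed Gegenbauer expansion).  Proof: with `Z = zonalSix τ` (continuous) and
  its negative part `f = -min(Z, 0) ≥ 0`, one has `Z f = -f²`; Weierstrass approximation gives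
  polynomials `p ≥ f ≥ 0` on `[-1,1]` with `p ≤ f + 2ε`, and the duality inequality
  `∫ (1-s²)² Z p ≥ 0` of `SphericalZonalSixDuality.lean` (orthogonality + positivity preservation
  of the ultraspherical polynomial heat flow) forces `∫ (1-s²)² f² ≤ 4ε sup|(1-s²)² Z|` for every
  `ε > 0`, hence `f = 0`;
* `monotoneOn_zonal` — **`s ↦ zonal τ s` is monotone on `[-1, 1]`**: the heat kernel of the round
  `S⁴` is a non-increasing function of the geodesic distance (the lemma of Cheeger–Yau behind
  their heat-kernel comparison theorem), by `monotoneOn_zonal_of_zonalSix_nonneg`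
  (`∂_s zonal = 5 e^{-4τ} zonalSix`).

Everything is proved; no named facts.

## References
* J. Cheeger, S.-T. Yau, *A lower bound for the heat kernel*, Comm. Pure Appl. Math. 34 (1981),
  465–480.
* E. B. Davies, *Heat Kernels and Spectral Theory*, CUP 1989, Ch. 5.
-/

noncomputable section

open scoped BigOperators Topology Polynomial Interval
open Filter Set MeasureTheory intervalIntegral Polynomial
open Literature.Geometry.Riemannian.SphericalCylinderEntropy

namespace Literature.Geometry.Riemannian.SphericalZonalKernelSeries

/-- A continuous non-negative function on `[-1, 1]` with `∫_{-1}^{1} (1-s²)² g² ≤ 0` vanishes on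
`(-1, 1)`. [folklore] -/
theorem eq_zero_of_integral_weight_mul_sq_nonpos {g : ℝ → ℝ} (hg : Continuous g)
    (hint : ∫ s in (-1 : ℝ)..1, (1 - s ^ 2) ^ 2 * g s ^ 2 ≤ 0) {y : ℝ} (hy : y ∈ Ioo (-1 : ℝ) 1) :
    g y = 0 := by
  by_contra hne
  have hpos0 : 0 < g y ^ 2 := by positivity
  set F : ℝ → ℝ := fun s => (1 - s ^ 2) ^ 2 * g s ^ 2 with hF
  have hFc : Continuous F := by rw [hF]; fun_prop
  have hFnn : ∀ s ∈ Icc (-1 : ℝ) 1, 0 ≤ F s := fun s hs =>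
    mul_nonneg (Literature.Analysis.SpecialFunctions.ultrasphericalWeight_nonneg 2 hs) (sq_nonneg _)
  have hev : ∀ᶠ s in 𝓝 y, 0 < g s ^ 2 :=
    (hg.pow 2).continuousAt.eventually (lt_mem_nhds hpos0)
  obtain ⟨ε, hε, hball⟩ := Metric.eventually_nhds_iff.1 hev
  set δ := min ε (min ((y + 1) / 2) ((1 - y) / 2)) with hδ
  have hδ0 : 0 < δ := lt_min hε (lt_min (by linarith [hy.1]) (by linarith [hy.2]))
  have hδε : δ ≤ ε := min_le_left _ _
  have hδy : δ ≤ (y + 1) / 2 := (min_le_right _ _).trans (min_le_left _ _)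
  have hδy' : δ ≤ (1 - y) / 2 := (min_le_right _ _).trans (min_le_right _ _)
  have hpos : 0 < ∫ s in (y - δ)..(y + δ), F s := by
    refine intervalIntegral.intervalIntegral_pos_of_pos_on (hFc.intervalIntegrable _ _)
      (fun s hs => ?_) (by linarith)
    have hs01 : s ∈ Ioo (-1 : ℝ) 1 := ⟨by linarith [hs.1], by linarith [hs.2]⟩
    have hgs : 0 < g s ^ 2 := hball (by
      rw [Real.dist_eq, abs_lt]; constructor <;> linarith [hs.1, hs.2])
    exact mul_pos (Literature.Analysis.SpecialFunctions.ultrasphericalWeight_pos 2 hs01) hgs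
  have hle : ∫ s in (y - δ)..(y + δ), F s ≤ ∫ s in (-1 : ℝ)..1, F s :=
    intervalIntegral.integral_mono_interval (by linarith) (by linarith) (by linarith)
      ((ae_restrict_mem measurableSet_Ioc).mono fun s hs => hFnn s ⟨hs.1.le, hs.2⟩)
      (hFc.intervalIntegrable _ _)
  linarith

/-- **Non-negativity of the `S⁶` zonal heat series**: `zonalSix τ s ≥ 0` for `τ > 0`, `s ∈ [-1,1]`
(positivity of the heat kernel of the round `S⁶`). [cite: Davies1989, Ch. 5 (positivity of heat kernels)] -/
theorem zonalSix_nonneg {τ : ℝ} (hτ : 0 < τ) : ∀ s ∈ Icc (-1 : ℝ) 1, 0 ≤ zonalSix τ s := by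
  set Z : ℝ → ℝ := zonalSix τ with hZ
  have hZc : Continuous Z := continuous_zonalSix hτ
  -- the negative part `f = -min(Z, 0)`
  set f : ℝ → ℝ := fun s => -min (Z s) 0 with hf
  have hfc : Continuous f := (hZc.min continuous_const).neg
  have hf0 : ∀ s, 0 ≤ f s := fun s => by simp only [hf]; linarith [min_le_right (Z s) 0]
  have hZf : ∀ s, Z s * f s = -(f s ^ 2) := by
    intro s
    simp only [hf]
    rcases le_total (Z s) 0 with h | h
    · rw [min_eq_left h]; ring
    · rw [min_eq_right h]; ring
  -- a bound for `(1-s²)² Z` on `[-1, 1]`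
  obtain ⟨B, hB⟩ := isCompact_Icc.exists_bound_of_continuousOn (s := Icc (-1 : ℝ) 1)
    ((by fun_prop : Continuous fun s : ℝ => (1 - s ^ 2) ^ 2 * Z s).continuousOn)
  have hB0 : 0 ≤ B := (norm_nonneg _).trans (hB 0 (by norm_num))
  -- `∫ ρ f² ≤ 4 ε B` for every `ε > 0`
  have hkey : ∫ s in (-1 : ℝ)..1, (1 - s ^ 2) ^ 2 * f s ^ 2 ≤ 0 := by
    refine le_of_forall_pos_le_add fun ε hε => ?_
    have hε4 : 0 < ε / (4 * B + 1) := div_pos hε (by linarith)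
    obtain ⟨q, hq⟩ := exists_polynomial_near_of_continuousOn (-1) 1 f hfc.continuousOn _ hε4
    set η := ε / (4 * B + 1) with hη
    -- `p = q + η ≥ f ≥ 0` on `[-1,1]`, `p ≤ f + 2η`
    set p : ℝ[X] := q + Polynomial.C η with hp
    have hp_eval : ∀ x, p.eval x = q.eval x + η := fun x => by simp [hp]
    have hpf : ∀ x ∈ Icc (-1 : ℝ) 1, f x ≤ p.eval x ∧ p.eval x ≤ f x + 2 * η := by
      intro x hx
      have h := abs_lt.1 (hq x hx)
      rw [hp_eval]
      constructor <;> linarith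
    have hp0 : ∀ x ∈ Icc (-1 : ℝ) 1, 0 ≤ p.eval x := fun x hx => (hf0 x).trans (hpf x hx).1
    have hdual := integral_weight_mul_zonalSix_mul_eval_nonneg hτ p hp0
    -- compare `∫ ρ Z p` with `∫ ρ Z f = -∫ ρ f²`
    have hi1 : IntervalIntegrable (fun s => (1 - s ^ 2) ^ 2 * Z s * p.eval s) volume (-1) 1 :=
      ((by fun_prop : Continuous fun s : ℝ => (1 - s ^ 2) ^ 2 * Z s).mul
        (Polynomial.continuous_eval₂ _ _)).intervalIntegrable _ _
    have hi2 : IntervalIntegrable (fun s => (1 - s ^ 2) ^ 2 * Z s * f s) volume (-1) 1 :=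
      ((by fun_prop : Continuous fun s : ℝ => (1 - s ^ 2) ^ 2 * Z s).mul hfc).intervalIntegrable _ _
    have hdiff : ‖∫ s in (-1 : ℝ)..1, ((1 - s ^ 2) ^ 2 * Z s * p.eval s - (1 - s ^ 2) ^ 2 * Z s * f s)‖
        ≤ B * (2 * η) * |1 - (-1)| := by
      refine intervalIntegral.norm_integral_le_of_norm_le_const fun s hs => ?_
      rw [uIoc_of_le (by norm_num)] at hs
      have hs' : s ∈ Icc (-1 : ℝ) 1 := ⟨hs.1.le, hs.2⟩
      rw [show (1 - s ^ 2) ^ 2 * Z s * p.eval s - (1 - s ^ 2) ^ 2 * Z s * f s =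
        ((1 - s ^ 2) ^ 2 * Z s) * (p.eval s - f s) by ring, norm_mul]
      refine mul_le_mul (hB s hs') ?_ (norm_nonneg _) hB0
      rw [Real.norm_eq_abs, abs_le]
      constructor <;> linarith [(hpf s hs').1, (hpf s hs').2]
    rw [intervalIntegral.integral_sub hi1 hi2, Real.norm_eq_abs] at hdiff
    have hZf' : ∫ s in (-1 : ℝ)..1, (1 - s ^ 2) ^ 2 * Z s * f s =
        -∫ s in (-1 : ℝ)..1, (1 - s ^ 2) ^ 2 * f s ^ 2 := by
      rw [← intervalIntegral.integral_neg]
      refine intervalIntegral.integral_congr fun s _ => ?_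
      simp only [mul_assoc, hZf s]
      ring
    rw [hZf'] at hdiff
    have habs := (abs_le.1 hdiff).2
    have h4 : B * (2 * η) * |1 - (-1 : ℝ)| = 4 * B * η := by
      rw [show (1 : ℝ) - (-1) = 2 by ring, abs_of_pos (by norm_num : (0 : ℝ) < 2)]; ring
    rw [h4] at habs
    have hηε : 4 * B * η ≤ ε := by
      rw [hη, mul_div_assoc', div_le_iff₀ (by linarith : (0 : ℝ) < 4 * B + 1)]
      nlinarith
    linarith
  -- hence `f = 0` on `(-1, 1)`, i.e. `Z ≥ 0` there; endpoints by continuity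
  have hopen : ∀ y ∈ Ioo (-1 : ℝ) 1, 0 ≤ Z y := by
    intro y hy
    have h := eq_zero_of_integral_weight_mul_sq_nonpos hfc hkey hy
    simp only [hf, neg_eq_zero] at h
    by_contra hneg
    push Not at hneg
    rw [min_eq_left hneg.le] at h
    exact hneg.ne h
  have hclosed : IsClosed {y : ℝ | 0 ≤ Z y} := isClosed_le continuous_const hZc
  have := hclosed.closure_subset_iff.2 (show Ioo (-1 : ℝ) 1 ⊆ _ from hopen)
  rw [closure_Ioo (by norm_num : (-1 : ℝ) ≠ 1)] at this
  exact fun s hs => this hs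

/-- **Monotonicity of the `S⁴` zonal heat kernel**: for `τ > 0`, `s ↦ zonal τ s` is monotone on
`[-1, 1]` — the heat kernel of the round `S⁴` is a non-increasing function of the geodesic distance
`arccos s`. [cite: CheegerYau1981, (radial monotonicity of the heat kernel of a model space)] -/
theorem monotoneOn_zonal {τ : ℝ} (hτ : 0 < τ) : MonotoneOn (zonal τ) (Icc (-1) 1) :=
  monotoneOn_zonal_of_zonalSix_nonneg hτ (zonalSix_nonneg hτ)

end Literature.Geometry.Riemannian.SphericalZonalKernelSeries
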